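import Summits.CriticalPhenomena.SAWScalingLimit.Theorems.SAWDevelopingMapHexConjectureWindowLocalityOfArchTightness
import Summits.CriticalPhenomena.SAWScalingLimit.Theorems.SAWDevelopingMapObservableToSLERestrictionCocycleHelpersFloor
import HarnessLib

/-!
# Crux `HexConjecture` (stmt-CriticalPhenomena-0808), line `root-locality-replaces-loewner`:
the lattice floor WINDOW of the re-plumbed bootstrap and its maximiser

Landing target:
`Summits/CriticalPhenomena/SAWScalingLimit/Theorems/SAWDevelopingMapHexConjectureWindowFloorData.lean`
(`--supports stmt-CriticalPhenomena-0808`; lead continuation prover-line-stmt-CriticalPhenomena-0808-c5-0).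

The bootstrap of crux-10472 (`FloorRatio.stub_restrictionCocycle`, p90257) and its clone under the
modulus hypothesis (`RootLocality.restrictionCocycle_of_floorRatioModulus`, p116941) consume SHORT-CHORD
LOCALITY at ONE lattice floor point `s_δ → s = a + t`: `Z_{Λ'δ}(a_δ,s_δ) ≥ (1-η) Z_{Λδ}(a_δ,s_δ)`.  The lower
bound of the squeeze only needs this at SOME floor point of a macroscopic window, and such a point exists
as soon as the far mass SUMMED over the window is small relative to the near mass SUMMED over the window —
the WINDOW-AVERAGED ARCH LOCALITY (WAL) of `…HexConjectureWindowLocalityOfArchTightness.lean` (implied by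
the registered `stub_halfPlaneArchTightness`, `stub_windowArchLocality_of_archTightness`, p121715).

`windowMaximiser`: for the nested admissible families `Λ' δ ⊆ Λ δ` of the mechanism stub (exact rows
`≥ m δ` in the rigid balls, `Λ δ` above its floor row, `δ·mid(a δ) → a`), a radius `ρ₂ ≤ ρ/2`, and the body
of WAL for `(η, θ₀, θ₁, R₀)` with `θ₀ ≤ 1/2`: eventually along `δ → 0⁺` there is a lattice floor point
`t = s_{x + d e₀}` of the row of `a δ = s_x` with `θ₁ ρ₂/δ ≤ d ≤ θ₀ ρ₂/δ`, boundary mid-edge of both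
families with nonempty walk spaces, at which `(1 - η) Z_{Λδ}(a δ, t) ≤ Z_{Λ'δ}(a δ, t)`.
Proof: the window `S = {d : θ₁R ≤ d ≤ θ₀R}` (`R = ρ₂/δ`) lies in the rigid ball, WAL at
`(R, x, Λ δ, B = {v ∈ Λ δ : |c_v - mid a δ| ≤ R})`, exact restriction (`archMass_le_archMass_add_farMass`:
a walk of `Λ δ` not in `Λ' δ` reaches distance `≥ R`), `Z_B ≤ Z_{Λδ}`, and a pigeonhole over `S`.
-/

noncomputable section

open scoped BigOperators Topology Classical
open Filter Set Metric
open Literature.Probability.LatticeModels (HexVertex hexGraph hexCenter Site)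
open Literature.Probability.RandomPlanarGeometry
open Literature.Probability.RandomPlanarGeometry.SAW
open Summit.CriticalPhenomena.SAWScalingLimit.Theorems.ObservableToSLE.FloorRatio

namespace Summit.CriticalPhenomena.SAWScalingLimit.Theorems.HexConjecture.RootLocality

/-! ### Small lemmas -/

/-- The integer window `{d : θ₁ R ≤ d ≤ θ₀ R}` as a `Finset`. [folklore] -/
theorem mem_window_iff (θ₁ θ₀ R : ℝ) (d : ℤ) :
    d ∈ Finset.Icc ⌈θ₁ * R⌉ ⌊θ₀ * R⌋ ↔ (θ₁ * R ≤ (d : ℝ) ∧ (d : ℝ) ≤ θ₀ * R) := by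
  rw [Finset.mem_Icc, Int.ceil_le, Int.le_floor]

/-- The integer window is nonempty once its real length is at least `1`. [folklore] -/
theorem window_nonempty {θ₁ θ₀ R : ℝ} (h : θ₁ * R + 1 ≤ θ₀ * R) :
    (Finset.Icc ⌈θ₁ * R⌉ ⌊θ₀ * R⌋).Nonempty := by
  refine ⟨⌈θ₁ * R⌉, Finset.mem_Icc.2 ⟨le_rfl, Int.le_floor.2 ?_⟩⟩
  have := Int.ceil_lt_add_one (θ₁ * R)
  linarith

/-- **Pigeonhole over a window.**  If `Σ_S g ≥ (1-η) Σ_S f` over a nonempty `S`, some term has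
`g d ≥ (1-η) f d`. [folklore] -/
theorem exists_ge_of_sum_ge {S : Finset ℤ} (hS : S.Nonempty) {f g : ℤ → ℝ} {η : ℝ}
    (h : (1 - η) * ∑ d ∈ S, f d ≤ ∑ d ∈ S, g d) : ∃ d ∈ S, (1 - η) * f d ≤ g d := by
  by_contra hcon
  push Not at hcon
  have : ∑ d ∈ S, g d < ∑ d ∈ S, (1 - η) * f d := Finset.sum_lt_sum_of_nonempty hS hcon
  rw [← Finset.mul_sum] at this
  linarith

/-- **The window point of the bootstrap.**  Abstract form of the selection: if termwise `Z ≤ Z' + F`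
(exact restriction: a walk not in the subdomain is far), `Z_B ≤ Z` (monotonicity), `η ≥ 0`, and the
window-averaged locality `Σ_S F ≤ η Σ_S Z_B` holds over a nonempty window `S`, then at some point of the
window `(1 - η) Z ≤ Z'`. [cite: LawlerSchrammWerner2004SAW, §3.4 ("SAW satisfies restriction")] -/
theorem exists_window_point {S : Finset ℤ} (hS : S.Nonempty) {Z Z' ZB F : ℤ → ℝ} {η : ℝ}
    (hη : 0 ≤ η) (hsplit : ∀ d ∈ S, Z d ≤ Z' d + F d) (hmono : ∀ d ∈ S, ZB d ≤ Z d)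
    (hW : ∑ d ∈ S, F d ≤ η * ∑ d ∈ S, ZB d) : ∃ d ∈ S, (1 - η) * Z d ≤ Z' d := by
  apply exists_ge_of_sum_ge hS
  have h1 : ∑ d ∈ S, Z d ≤ ∑ d ∈ S, Z' d + ∑ d ∈ S, F d := by
    rw [← Finset.sum_add_distrib]; exact Finset.sum_le_sum hsplit
  have h2 : ∑ d ∈ S, ZB d ≤ ∑ d ∈ S, Z d := Finset.sum_le_sum hmono
  have h3 : η * ∑ d ∈ S, ZB d ≤ η * ∑ d ∈ S, Z d := mul_le_mul_of_nonneg_left h2 hη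
  nlinarith

/-- **Position of a window point.**  The scaled midpoint of the floor mid-edge `s_{x + d e₀}` is the
scaled midpoint of `s_x` shifted by the real number `δ d`. [folklore] -/
theorem smul_hexMidpoint_offset (x : Site 2) (d : ℤ) (δ : ℝ) :
    (δ : ℂ) * hexMidpoint s((x + Pi.single 0 d - Pi.single 1 1, 1), (x + Pi.single 0 d, 0)) =
      (δ : ℂ) * hexMidpoint s((x - Pi.single 1 1, 1), (x, 0)) + ((δ * d : ℝ) : ℂ) := by
  have hre : (hexMidpoint s((x + Pi.single 0 d - Pi.single 1 1, 1), (x + Pi.single 0 d, 0))).re =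
      (hexMidpoint s((x - Pi.single 1 1, 1), (x, 0))).re + d := by
    rw [re_hexMidpoint_floorEdge, re_hexMidpoint_floorEdge, offsetCell_apply_one]
    have h0 : ((x + Pi.single 0 d : Site 2) 0 : ℝ) = (x 0 : ℝ) + d := by
      have := offsetCell_sub x d
      have h' : (x + Pi.single 0 d : Site 2) 0 = x 0 + d := by linarith
      exact_mod_cast h'
    rw [h0]; ring
  have him : (hexMidpoint s((x + Pi.single 0 d - Pi.single 1 1, 1), (x + Pi.single 0 d, 0))).im =
      (hexMidpoint s((x - Pi.single 1 1, 1), (x, 0))).im := by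
    rw [im_hexMidpoint_floorEdge, im_hexMidpoint_floorEdge, offsetCell_apply_one]
  apply Complex.ext
  · rw [Complex.add_re, Complex.re_ofReal_mul, Complex.re_ofReal_mul, Complex.ofReal_re, hre]; ring
  · rw [Complex.add_im, Complex.im_ofReal_mul, Complex.im_ofReal_mul, Complex.ofReal_im, him]; ring

/-- Distance from a window point to the root along the floor: `dist (mid s_x) (mid s_{x + d e₀}) = |d|`.
[folklore] -/
theorem dist_hexMidpoint_offset (x : Site 2) (d : ℤ) :
    dist (hexMidpoint s((x - Pi.single 1 1, 1), (x, 0)))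
      (hexMidpoint s((x + Pi.single 0 d - Pi.single 1 1, 1), (x + Pi.single 0 d, 0))) = |(d : ℝ)| := by
  have h1 : (x + Pi.single 0 d : Site 2) 1 = x 1 := offsetCell_apply_one x d
  have h2 : (x 0 - (x + Pi.single 0 d : Site 2) 0 : ℤ) = -d := by
    have := offsetCell_sub x d; omega
  have h := dist_hexMidpoint_floorEdge x (x + Pi.single 0 d) h1
  rw [h2] at h
  refine h.trans ?_
  push_cast
  exact abs_neg _

/-! ### The window maximiser -/

/-- **THE WINDOW MAXIMISER OF THE RE-PLUMBED BOOTSTRAP.**  See the module docstring.  Hypotheses: the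
admissibility clause of the mechanism stub (eventually along `δ → 0⁺`), the root limit `δ·mid(a δ) → a`, a
radius `0 < ρ₂ ≤ ρ/2`, window parameters `0 < θ₁ < θ₀ ≤ 1/2`, a threshold `R₀ > 0`, a ratio `η ≥ 0`, and the body
of the window-averaged arch locality for `(η, θ₀, θ₁, R₀)`.  Conclusion: eventually there are a root cell `x`
(`a δ = s_x`, `x₁ = m δ`) and an offset `d` in the window `[θ₁ ρ₂/δ, θ₀ ρ₂/δ]` such that the floor mid-edge
`t = s_{x + d e₀}` is a boundary mid-edge of `Λ δ` and of `Λ' δ` with nonempty walk spaces from `a δ`, and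
`(1 - η) · Z_{Λ δ}(a δ, t) ≤ Z_{Λ' δ}(a δ, t)`.
[cite: LawlerSchrammWerner2004SAW, §3.4 ("SAW satisfies restriction")] -/
theorem windowMaximiser (D D' : DobrushinDomain) (ρ : ℝ) (Λ Λ' : ℝ → Finset HexVertex) (m : ℝ → ℤ)
    (a b : ℝ → Sym2 HexVertex) (hρ : 0 < ρ)
    (hev : ∀ᶠ δ : ℝ in 𝓝[>] 0,
      Λ' δ ⊆ Λ δ ∧ hexDomainSimplyConnected (Λ δ) ∧ hexDomainSimplyConnected (Λ' δ) ∧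
      (hexGraph.induce (↑(Λ δ) : Set HexVertex)).Preconnected ∧
      (hexGraph.induce (↑(Λ' δ) : Set HexVertex)).Preconnected ∧
      a δ ∈ hexDomainBoundary (Λ δ) ∧ b δ ∈ hexDomainBoundary (Λ δ) ∧
      a δ ∈ hexDomainBoundary (Λ' δ) ∧ b δ ∈ hexDomainBoundary (Λ' δ) ∧
      Nonempty (HexMidEdgeSAW (Λ' δ) (a δ) (b δ)) ∧
      (∀ v ∈ Λ δ, (δ : ℂ) * hexCenter v ∈ D.carrier ∧ m δ ≤ v.1 1) ∧
      (∀ v ∈ Λ' δ, (δ : ℂ) * hexCenter v ∈ D'.carrier) ∧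
      (∀ v : HexVertex, (δ : ℂ) * hexCenter v ∈ ball (D.pt 0) ρ ∪ ball (D.pt 1) ρ →
        ((v ∈ Λ δ ↔ m δ ≤ v.1 1) ∧ (v ∈ Λ' δ ↔ m δ ≤ v.1 1))))
    (ha : Tendsto (fun δ : ℝ => (δ : ℂ) * hexMidpoint (a δ)) (𝓝[>] 0) (𝓝 (D.pt 0)))
    {ρ₂ η θ₀ θ₁ R₀ : ℝ} (hη : 0 ≤ η) (hρ₂ : 0 < ρ₂) (hρ₂ρ : ρ₂ ≤ ρ / 2) (hθ₁ : 0 < θ₁) (hθ₁₀ : θ₁ < θ₀)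
    (hθ₀ : θ₀ ≤ 1 / 2) (hR₀ : 0 < R₀)
    (hW : ∀ R : ℝ, R₀ ≤ R → ∀ (x : Site 2) (L B : Finset HexVertex) (S : Finset ℤ),
      (∀ v ∈ L, x 1 ≤ v.1 1) →
      (∀ v : HexVertex, v ∈ B ↔ (x 1 ≤ v.1 1 ∧
        dist (hexCenter v) (hexMidpoint s((x - Pi.single 1 1, 1), (x, 0))) ≤ R)) →
      (∀ d : ℤ, d ∈ S ↔ (θ₁ * R ≤ (d : ℝ) ∧ (d : ℝ) ≤ θ₀ * R)) →
      ∑ d ∈ S, (∑ γ : HexMidEdgeSAW L s((x - Pi.single 1 1, 1), (x, 0))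
          s((x + Pi.single 0 d - Pi.single 1 1, 1), (x + Pi.single 0 d, 0)),
        if ∃ v ∈ γ.verts, R ≤ dist (hexCenter v) (hexMidpoint s((x - Pi.single 1 1, 1), (x, 0)))
        then hexCriticalFugacity ^ γ.length else 0) ≤
      η * ∑ d ∈ S, ∑ γ : HexMidEdgeSAW B s((x - Pi.single 1 1, 1), (x, 0))
          s((x + Pi.single 0 d - Pi.single 1 1, 1), (x + Pi.single 0 d, 0)),
        hexCriticalFugacity ^ γ.length) :
    ∀ᶠ δ : ℝ in 𝓝[>] 0, ∃ (x : Site 2) (d : ℤ),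
      x 1 = m δ ∧ a δ = s((x - Pi.single 1 1, 1), (x, 0)) ∧
      θ₁ * (ρ₂ / δ) ≤ (d : ℝ) ∧ (d : ℝ) ≤ θ₀ * (ρ₂ / δ) ∧
      (∀ v ∈ Λ δ, x 1 ≤ v.1 1) ∧ (∀ v ∈ Λ' δ, x 1 ≤ v.1 1) ∧
      s((x + Pi.single 0 d - Pi.single 1 1, 1), (x + Pi.single 0 d, 0)) ∈ hexDomainBoundary (Λ δ) ∧
      s((x + Pi.single 0 d - Pi.single 1 1, 1), (x + Pi.single 0 d, 0)) ∈ hexDomainBoundary (Λ' δ) ∧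
      Nonempty (HexMidEdgeSAW (Λ δ) (a δ)
        s((x + Pi.single 0 d - Pi.single 1 1, 1), (x + Pi.single 0 d, 0))) ∧
      Nonempty (HexMidEdgeSAW (Λ' δ) (a δ)
        s((x + Pi.single 0 d - Pi.single 1 1, 1), (x + Pi.single 0 d, 0))) ∧
      (1 - η) * (∑ γ : HexMidEdgeSAW (Λ δ) (a δ)
          s((x + Pi.single 0 d - Pi.single 1 1, 1), (x + Pi.single 0 d, 0)), hexCriticalFugacity ^ γ.length) ≤
        ∑ γ : HexMidEdgeSAW (Λ' δ) (a δ)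
          s((x + Pi.single 0 d - Pi.single 1 1, 1), (x + Pi.single 0 d, 0)), hexCriticalFugacity ^ γ.length := by
  set a₀ : ℂ := D.pt 0 with ha₀
  -- (A) floor form of `a δ`
  have hδρ : ∀ᶠ δ : ℝ in 𝓝[>] 0, δ < ρ := mem_nhdsWithin_of_mem_nhds (Iio_mem_nhds hρ)
  have e1 : ∀ᶠ δ : ℝ in 𝓝[>] 0, dist ((δ : ℂ) * hexMidpoint (a δ)) a₀ < ρ₂ / 2 :=
    Metric.tendsto_nhds.1 ha _ (by positivity)
  have hA : ∀ᶠ δ : ℝ in 𝓝[>] 0, ∃ x : Site 2, x 1 = m δ ∧ a δ = s((x - Pi.single 1 1, 1), (x, 0)) ∧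
      (x, (0 : Fin 2)) ∈ Λ δ ∧ (x, (0 : Fin 2)) ∈ Λ' δ ∧
      (x - Pi.single 1 1, (1 : Fin 2)) ∉ Λ δ ∧ (x - Pi.single 1 1, (1 : Fin 2)) ∉ Λ' δ := by
    have h1 : ∀ᶠ δ : ℝ in 𝓝[>] 0, dist ((δ : ℂ) * hexMidpoint (a δ)) a₀ < ρ / 2 :=
      Metric.tendsto_nhds.1 ha _ (half_pos hρ)
    filter_upwards [hev, h1, hδρ, self_mem_nhdsWithin] with δ hevδ h1 h2 hδ
    obtain ⟨-, -, -, -, -, haΛ, -, -, -, -, -, -, hrows⟩ := hevδ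
    exact floorEdge_data hδ h2 haΛ h1 fun v hv => hrows v (Or.inl hv)
  -- (B) eventual smallness of `δ`
  have e2 : ∀ᶠ δ : ℝ in 𝓝[>] 0, δ ≤ ρ₂ / R₀ :=
    mem_nhdsWithin_of_mem_nhds (Iic_mem_nhds (by positivity))
  have e3 : ∀ᶠ δ : ℝ in 𝓝[>] 0, δ ≤ (θ₀ - θ₁) * ρ₂ :=
    mem_nhdsWithin_of_mem_nhds (Iic_mem_nhds (mul_pos (by linarith) hρ₂))
  have e4 : ∀ᶠ δ : ℝ in 𝓝[>] 0, δ < ρ₂ / 2 := mem_nhdsWithin_of_mem_nhds (Iio_mem_nhds (by positivity))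
  filter_upwards [hev, hA, e1, e2, e3, e4, self_mem_nhdsWithin] with δ hevδ
    ⟨x, hx1, hax, hx0Λ, hx0Λ', hxdΛ, hxdΛ'⟩ e1 e2 e3 e4 hδ
  obtain ⟨hsubΛ, -, -, hconn, hconn', -, -, haΛ', -, -, hΛD, -, hrows⟩ := hevδ
  have hδ0 : (0 : ℝ) < δ := hδ
  have hrowsΛ : ∀ v ∈ Λ δ, x 1 ≤ v.1 1 := fun v hv => hx1 ▸ (hΛD v hv).2
  have hrowsΛ' : ∀ v ∈ Λ' δ, x 1 ≤ v.1 1 := fun v hv => hrowsΛ v (hsubΛ hv)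
  -- the lattice radius `R = ρ₂ / δ`
  set R : ℝ := ρ₂ / δ with hRdef
  have hRpos : 0 < R := div_pos hρ₂ hδ0
  have hRδ : δ * R = ρ₂ := by rw [hRdef]; field_simp
  have hR₀R : R₀ ≤ R := by
    rw [hRdef, le_div_iff₀ hδ0]
    calc R₀ * δ ≤ R₀ * (ρ₂ / R₀) := mul_le_mul_of_nonneg_left e2 hR₀.le
      _ = ρ₂ := by field_simp
  -- a lattice point within lattice distance `R` of `mid (a δ)` (plus one half) lies in the rigid ball
  have hball : ∀ v : HexVertex, dist (hexCenter v) (hexMidpoint (a δ)) ≤ R + 1 / 2 →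
      (δ : ℂ) * hexCenter v ∈ ball a₀ ρ := by
    intro v hv
    rw [mem_ball]
    have h := dist_mesh_le hδ0.le hv e1.le
    have h' : δ * (R + 1 / 2) = ρ₂ + δ / 2 := by rw [mul_add, hRδ]; ring
    calc dist ((δ : ℂ) * hexCenter v) a₀ ≤ δ * (R + 1 / 2) + ρ₂ / 2 := h
      _ = ρ₂ + δ / 2 + ρ₂ / 2 := by rw [h']
      _ < ρ := by linarith
  -- the half-box `B`
  set B : Finset HexVertex := (Λ δ).filter fun v => dist (hexCenter v) (hexMidpoint (a δ)) ≤ R with hB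
  have hBsub : B ⊆ Λ δ := Finset.filter_subset _ _
  have hBiff : ∀ v : HexVertex, v ∈ B ↔ (x 1 ≤ v.1 1 ∧
      dist (hexCenter v) (hexMidpoint s((x - Pi.single 1 1, 1), (x, 0))) ≤ R) := by
    intro v
    rw [hB, Finset.mem_filter, ← hax]
    constructor
    · rintro ⟨hvΛ, hvd⟩
      exact ⟨hrowsΛ v hvΛ, hvd⟩
    · rintro ⟨hvrow, hvd⟩
      refine ⟨?_, hvd⟩
      exact (hrows v (Or.inl (hball v (by linarith)))).1.2 (hx1 ▸ hvrow)
  -- the window `S`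
  set S : Finset ℤ := Finset.Icc ⌈θ₁ * R⌉ ⌊θ₀ * R⌋ with hS
  have hSiff : ∀ d : ℤ, d ∈ S ↔ (θ₁ * R ≤ (d : ℝ) ∧ (d : ℝ) ≤ θ₀ * R) := mem_window_iff θ₁ θ₀ R
  have hSne : S.Nonempty := by
    apply window_nonempty
    have h1 : (θ₀ - θ₁) * ρ₂ / δ ≥ 1 := by
      rw [ge_iff_le, le_div_iff₀ hδ0, one_mul]; exact e3
    have h2 : (θ₀ - θ₁) * ρ₂ / δ = θ₀ * R - θ₁ * R := by rw [hRdef]; ring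
    linarith
  -- WAL on the window
  have hWAL := hW R hR₀R x (Λ δ) B S hrowsΛ hBiff hSiff
  -- facts about every window point
  have hpt : ∀ d ∈ S, 0 < d ∧
      (x + Pi.single 0 d, (0 : Fin 2)) ∈ Λ δ ∧ (x + Pi.single 0 d, (0 : Fin 2)) ∈ Λ' δ := by
    intro d hd
    obtain ⟨hd1, hd2⟩ := (hSiff d).1 hd
    have hdpos : (0 : ℝ) < d := lt_of_lt_of_le (mul_pos hθ₁ hRpos) hd1
    have hd0 : 0 < d := by exact_mod_cast hdpos
    -- the inner endpoint is in the rigid ball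
    have hin : (δ : ℂ) * hexCenter (x + Pi.single 0 d, (0 : Fin 2)) ∈ ball a₀ ρ := by
      apply hball
      have hedge : s((x + Pi.single 0 d - Pi.single 1 1, (1 : Fin 2)), (x + Pi.single 0 d, 0)) ∈
          hexGraph.edgeSet := (SimpleGraph.mem_edgeSet hexGraph).2 (adj_floorEdge _)
      have h1 := dist_hexCenter_hexMidpoint_le hedge (Sym2.mem_mk_right _ _)
      have h2 : dist (hexMidpoint s((x + Pi.single 0 d - Pi.single 1 1, (1 : Fin 2)), (x + Pi.single 0 d, 0)))
          (hexMidpoint (a δ)) ≤ θ₀ * R := by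
        rw [hax, dist_comm, dist_hexMidpoint_offset, abs_of_pos hdpos]; exact hd2
      have h3 : θ₀ * R ≤ R := by nlinarith
      have h4 := dist_triangle (hexCenter (x + Pi.single 0 d, (0 : Fin 2)))
        (hexMidpoint s((x + Pi.single 0 d - Pi.single 1 1, (1 : Fin 2)), (x + Pi.single 0 d, 0)))
        (hexMidpoint (a δ))
      linarith
    have hrow : m δ ≤ (x + Pi.single 0 d : Site 2) 1 := by
      rw [offsetCell_apply_one, hx1]
    exact ⟨hd0, (hrows _ (Or.inl hin)).1.2 hrow, (hrows _ (Or.inl hin)).2.2 hrow⟩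
  -- near region: a vertex of `Λ δ` closer than `R` to `mid (a δ)` lies in `Λ' δ`
  have hnear : ∀ v ∈ Λ δ, dist (hexCenter v) (hexMidpoint (a δ)) < R → v ∈ Λ' δ := by
    intro v hv hvd
    exact (hrows v (Or.inl (hball v (by linarith)))).2.2 (hΛD v hv).2
  have haΛ'mid : a δ ∈ hexDomainMidEdges (Λ' δ) := hexDomainBoundary_subset _ haΛ'
  -- the maximiser (abstract selection over the window)
  rw [hax] at haΛ'mid hnear
  obtain ⟨d, hdS, hdmax⟩ := exists_window_point hSne
    (Z := fun d => ∑ γ : HexMidEdgeSAW (Λ δ) s((x - Pi.single 1 1, 1), (x, 0))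
      s((x + Pi.single 0 d - Pi.single 1 1, 1), (x + Pi.single 0 d, 0)), hexCriticalFugacity ^ γ.length)
    (Z' := fun d => ∑ γ : HexMidEdgeSAW (Λ' δ) s((x - Pi.single 1 1, 1), (x, 0))
      s((x + Pi.single 0 d - Pi.single 1 1, 1), (x + Pi.single 0 d, 0)), hexCriticalFugacity ^ γ.length)
    (ZB := fun d => ∑ γ : HexMidEdgeSAW B s((x - Pi.single 1 1, 1), (x, 0))
      s((x + Pi.single 0 d - Pi.single 1 1, 1), (x + Pi.single 0 d, 0)), hexCriticalFugacity ^ γ.length)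
    (F := fun d => ∑ γ : HexMidEdgeSAW (Λ δ) s((x - Pi.single 1 1, 1), (x, 0))
      s((x + Pi.single 0 d - Pi.single 1 1, 1), (x + Pi.single 0 d, 0)),
        if ∃ v ∈ γ.verts, R ≤ dist (hexCenter v) (hexMidpoint s((x - Pi.single 1 1, 1), (x, 0)))
        then hexCriticalFugacity ^ γ.length else 0)
    hη
    (fun d _ => archMass_le_archMass_add_farMass haΛ'mid hnear)
    (fun d _ => archMass_mono hBsub _ _)
    hWAL
  obtain ⟨hd0, hy0Λ, hy0Λ'⟩ := hpt d hdS
  obtain ⟨hd1, hd2⟩ := (hSiff d).1 hdS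
  have hy1 : (x + Pi.single 0 d : Site 2) 1 = x 1 := offsetCell_apply_one x d
  have hyx : (x + Pi.single 0 d : Site 2) ≠ x := offsetCell_ne x hd0.ne'
  have hne : s((x - Pi.single 1 1, (1 : Fin 2)), (x, 0)) ≠
      s((x + Pi.single 0 d - Pi.single 1 1, 1), (x + Pi.single 0 d, 0)) := by
    intro h
    have hmem : (x + Pi.single 0 d, (0 : Fin 2)) ∈ s((x - Pi.single 1 1, (1 : Fin 2)), (x, 0)) := by
      rw [h]; exact Sym2.mem_mk_right _ _
    rcases Sym2.mem_iff.1 hmem with h' | h'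
    · exact (show (0 : Fin 2) ≠ 1 by decide) (congrArg Prod.snd h')
    · exact hyx (congrArg Prod.fst h')
  have hydΛ : (x + Pi.single 0 d - Pi.single 1 1, (1 : Fin 2)) ∉ Λ δ := floorEdge_down_not_mem hrowsΛ hy1
  have hydΛ' : (x + Pi.single 0 d - Pi.single 1 1, (1 : Fin 2)) ∉ Λ' δ := floorEdge_down_not_mem hrowsΛ' hy1
  refine ⟨x, d, hx1, hax, hd1, hd2, hrowsΛ, hrowsΛ',
    floorEdge_mem_hexDomainBoundary hrowsΛ hy1 hy0Λ, floorEdge_mem_hexDomainBoundary hrowsΛ' hy1 hy0Λ',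
    ?_, ?_, ?_⟩
  · rw [hax]
    exact nonempty_hexMidEdgeSAW_of_preconnected hconn (adj_floorEdge x) hxdΛ hx0Λ hydΛ hy0Λ hne
  · rw [hax]
    exact nonempty_hexMidEdgeSAW_of_preconnected hconn' (adj_floorEdge x) hxdΛ' hx0Λ' hydΛ' hy0Λ' hne
  · rw [hax]
    exact hdmax

/-! ### Registered form -/

/-- **Registered sub-goal `stub_windowMaximiser`** (crux item stmt-CriticalPhenomena-0808, line
`root-locality-replaces-loewner`, lead continuation c5): the window maximiser of the re-plumbed bootstrap
(`windowMaximiser`), signature fully qualified. [cite: LawlerSchrammWerner2004SAW, §3.4 ("SAW satisfies restriction")] -/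
theorem stub_windowMaximiser : ∀ (D D' : Literature.Probability.RandomPlanarGeometry.DobrushinDomain) (ρ : ℝ) (Λ Λ' : ℝ → Finset Literature.Probability.LatticeModels.HexVertex) (m : ℝ → ℤ) (a b : ℝ → Sym2 Literature.Probability.LatticeModels.HexVertex), 0 < ρ → (∀ᶠ δ : ℝ in nhdsWithin 0 (Set.Ioi 0), Λ' δ ⊆ Λ δ ∧ Literature.Probability.RandomPlanarGeometry.SAW.hexDomainSimplyConnected (Λ δ) ∧ Literature.Probability.RandomPlanarGeometry.SAW.hexDomainSimplyConnected (Λ' δ) ∧ (Literature.Probability.LatticeModels.hexGraph.induce (↑(Λ δ) : Set Literature.Probability.LatticeModels.HexVertex)).Preconnected ∧ (Literature.Probability.LatticeModels.hexGraph.induce (↑(Λ' δ) : Set Literature.Probability.LatticeModels.HexVertex)).Preconnected ∧ a δ ∈ Literature.Probability.RandomPlanarGeometry.SAW.hexDomainBoundary (Λ δ) ∧ b δ ∈ Literature.Probability.RandomPlanarGeometry.SAW.hexDomainBoundary (Λ δ) ∧ a δ ∈ Literature.Probability.RandomPlanarGeometry.SAW.hexDomainBoundary (Λ' δ) ∧ b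 δ ∈ Literature.Probability.RandomPlanarGeometry.SAW.hexDomainBoundary (Λ' δ) ∧ Nonempty (Literature.Probability.RandomPlanarGeometry.SAW.HexMidEdgeSAW (Λ' δ) (a δ) (b δ)) ∧ (∀ v ∈ Λ δ, (δ : ℂ) * Literature.Probability.LatticeModels.hexCenter v ∈ D.carrier ∧ m δ ≤ v.1 1) ∧ (∀ v ∈ Λ' δ, (δ : ℂ) * Literature.Probability.LatticeModels.hexCenter v ∈ D'.carrier) ∧ (∀ v : Literature.Probability.LatticeModels.HexVertex, (δ : ℂ) * Literature.Probability.LatticeModels.hexCenter v ∈ Metric.ball (D.pt 0) ρ ∪ Metric.ball (D.pt 1) ρ → ((v ∈ Λ δ ↔ m δ ≤ v.1 1) ∧ (v ∈ Λ' δ ↔ m δ ≤ v.1 1)))) → Filter.Tendsto (fun δ : ℝ => (δ : ℂ) * Literature.Probability.RandomPlanarGeometry.SAW.hexMidpoint (a δ)) (nhdsWithin 0 (Set.Ioi 0)) (nhds (D.pt 0)) → ∀ (ρ₂ η θ₀ θ₁ R₀ : ℝ), 0 ≤ η → 0 < ρ₂ → ρ₂ ≤ ρ / 2 → 0 < θ₁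 → θ₁ < θ₀ → θ₀ ≤ 1 / 2 → 0 < R₀ → (∀ R : ℝ, R₀ ≤ R → ∀ (x : Literature.Probability.LatticeModels.Site 2) (L B : Finset Literature.Probability.LatticeModels.HexVertex) (S : Finset ℤ), (∀ v ∈ L, x 1 ≤ v.1 1) → (∀ v : Literature.Probability.LatticeModels.HexVertex, v ∈ B ↔ (x 1 ≤ v.1 1 ∧ dist (Literature.Probability.LatticeModels.hexCenter v) (Literature.Probability.RandomPlanarGeometry.SAW.hexMidpoint s((x - Pi.single 1 1, 1), (x, 0))) ≤ R)) → (∀ d : ℤ, d ∈ S ↔ (θ₁ * R ≤ (d : ℝ) ∧ (d : ℝ) ≤ θ₀ * R)) → ∑ d ∈ S, (∑ γ : Literature.Probability.RandomPlanarGeometry.SAW.HexMidEdgeSAW L s((x - Pi.single 1 1, 1), (x, 0)) s((x + Pi.single 0 d - Pi.single 1 1, 1), (x + Pi.single 0 d, 0)), if ∃ v ∈ γ.verts, R ≤ dist (Literature.Probability.LatticeModels.hexCenter v) (Literature.Probability.RandomPlanarGeometry.SAW.hexMidpoint s((x - Pi.single 1 1, 1), (x, 0))) then Literature.Probability.RandomPlanarGeometry.SAW.hexCriticalFugacity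 ^ γ.length else 0) ≤ η * ∑ d ∈ S, ∑ γ : Literature.Probability.RandomPlanarGeometry.SAW.HexMidEdgeSAW B s((x - Pi.single 1 1, 1), (x, 0)) s((x + Pi.single 0 d - Pi.single 1 1, 1), (x + Pi.single 0 d, 0)), Literature.Probability.RandomPlanarGeometry.SAW.hexCriticalFugacity ^ γ.length) → ∀ᶠ δ : ℝ in nhdsWithin 0 (Set.Ioi 0), ∃ (x : Literature.Probability.LatticeModels.Site 2) (d : ℤ), x 1 = m δ ∧ a δ = s((x - Pi.single 1 1, 1), (x, 0)) ∧ θ₁ * (ρ₂ / δ) ≤ (d : ℝ) ∧ (d : ℝ) ≤ θ₀ * (ρ₂ / δ) ∧ (∀ v ∈ Λ δ, x 1 ≤ v.1 1) ∧ (∀ v ∈ Λ' δ, x 1 ≤ v.1 1) ∧ s((x + Pi.single 0 d - Pi.single 1 1, 1), (x + Pi.single 0 d, 0)) ∈ Literature.Probability.RandomPlanarGeometry.SAW.hexDomainBoundary (Λ δ) ∧ s((x + Pi.single 0 d - Pi.single 1 1, 1), (x + Pi.single 0 d, 0)) ∈ Literature.Probability.RandomPlanarGeometry.SAW.hexDomainBoundary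 (Λ' δ) ∧ Nonempty (Literature.Probability.RandomPlanarGeometry.SAW.HexMidEdgeSAW (Λ δ) (a δ) s((x + Pi.single 0 d - Pi.single 1 1, 1), (x + Pi.single 0 d, 0))) ∧ Nonempty (Literature.Probability.RandomPlanarGeometry.SAW.HexMidEdgeSAW (Λ' δ) (a δ) s((x + Pi.single 0 d - Pi.single 1 1, 1), (x + Pi.single 0 d, 0))) ∧ (1 - η) * (∑ γ : Literature.Probability.RandomPlanarGeometry.SAW.HexMidEdgeSAW (Λ δ) (a δ) s((x + Pi.single 0 d - Pi.single 1 1, 1), (x + Pi.single 0 d, 0)), Literature.Probability.RandomPlanarGeometry.SAW.hexCriticalFugacity ^ γ.length) ≤ ∑ γ : Literature.Probability.RandomPlanarGeometry.SAW.HexMidEdgeSAW (Λ' δ) (a δ) s((x + Pi.single 0 d - Pi.single 1 1, 1), (x + Pi.single 0 d, 0)), Literature.Probability.RandomPlanarGeometry.SAW.hexCriticalFugacity ^ γ.length :=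
  fun D D' ρ Λ Λ' m a b hρ hev ha _ _ _ _ _ hη hρ₂ hρ₂ρ hθ₁ hθ₁₀ hθ₀ hR₀ hW =>
    windowMaximiser D D' ρ Λ Λ' m a b hρ hev ha hη hρ₂ hρ₂ρ hθ₁ hθ₁₀ hθ₀ hR₀ hW

/-- **Registered sub-goal `stub_existsWindowPoint`** (crux item stmt-CriticalPhenomena-0808, line
`root-locality-replaces-loewner`, lead continuation c5): the abstract selection of the window point
(`exists_window_point`). [folklore] -/
theorem stub_existsWindowPoint : ∀ (S : Finset ℤ), S.Nonempty → ∀ (Z Z' ZB F : ℤ → ℝ) (η : ℝ), 0 ≤ η → (∀ d ∈ S, Z d ≤ Z' d + F d) → (∀ d ∈ S, ZB d ≤ Z d) → ∑ d ∈ S, F d ≤ η * ∑ d ∈ S, ZB d → ∃ d ∈ S, (1 - η) * Z d ≤ Z' d :=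
  fun _ hS _ _ _ _ _ hη hsplit hmono hW => exists_window_point hS hη hsplit hmono hW

end Summit.CriticalPhenomena.SAWScalingLimit.Theorems.HexConjecture.RootLocality

end
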